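/-
b2b-lace packet, ANALYTIC ORACLE seat gen 8 (unit `b2b-lace-oracle-g8`).  The remaining two SRW integrals of
[NoBLE17] §3.3.4, `T_{n,l}(x)` and `U_{n,l}(x)` (with `D̂^{sin}` and `M̂`), and their printed §5.2 majorants in
terms of `K_{n,l}`.  d-generic; no dimension sentence.
-/
import Literature.Probability.FitznerVanDerHofstad2017.SrwIntegralBounds
import HarnessLib

/-!
# The SRW integrals `T_{n,l}(x)`, `U_{n,l}(x)` of the `f₃` improvement and their `K`-majorants

CITATION HEADER (PLACEMENT v2). Part of a certified REPRODUCTION of R. Fitzner, R. van der Hofstad,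
*Generalized approach to the non-backtracking lace expansion*, Probab. Theory Related Fields 169 (2017)
1041–1119 [NoBLE17] (arXiv:1506.07969), §3.3.3–§3.3.4 and §5.2, as consumed by [FvdH17] (EJP 22 no. 43) Prop. 2.2:

> [NoBLE17] §3.3.3 p. 1070: "`Σ_s (∂_s D̂(k))² = d⁻² Σ_s sin²(k_s) =: D̂^{sin}(k)`", "We define
> `M̂(k) = D̂(k) − 2 D̂^{sin}(k) Ĉ(k)`"; §3.3.4 (3.37)–(3.38) p. 1071:
> "`T_{n,l}(x) = ∫ |D̂^l(k)| Ĉ(k)ⁿ |D̂^{(x)}(k)| |M̂(k)| dk/(2π)^d`, `U_{n,l}(x) = ∫ |D̂^l(k)| Ĉ(k)ⁿ |D̂^{(x)}(k)| |D̂^{sin}(k)| dk/(2π)^d`";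
> §5.2 p. 1092: "`|M̂(k)| ≤ |D̂(k)| + 2|D̂^{sin}(k)|Ĉ(k) ≤ |D̂(k)| + min{4/d, (2/d)Ĉ(k)}`. This leads to
> `T_{n,l}(x) ≤ K_{n,l+1}(x) + min{(4/d) K_{n,l}(x), (2/d) K_{n+1,l}(x)}`" and "`U_{n,l}(x) ≤ (1/d) K_{n,l}(x)`".

## What is here (definitions transcribed; every bound a kernel theorem; cites are locators)

* `Dsin d k = (Σ_s sin²(k_s))/d²`, `Mhat d k = D̂(k) − 2 D̂^{sin}(k) Ĉ(k)` (`Ĉ = Chat d 1`; at the single point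
  `k = 0` Lean's `Chat d 1 0 = 1/0 = 0`, immaterial under the integral);
* `srwT d n l x`, `srwU d n l x` — (3.37), (3.38), normalised by `(2π)^d` exactly like the tree's `srwI`, `srwK`;
* `Dsin_le_inv : D̂^{sin} ≤ 1/d`, `Dsin_le : D̂^{sin} ≤ (2/d)(1 − D̂)` (from `sin² = (1−cos)(1+cos) ≤ 2(1−cos)`),
  hence `two_mul_Dsin_mul_Chat_le_div : 2 D̂^{sin} Ĉ ≤ (2/d) Ĉ` and `two_mul_Dsin_mul_Chat_le : 2 D̂^{sin} Ĉ ≤ 4/d`,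
  `abs_Mhat_le : |M̂| ≤ |D̂| + 2 D̂^{sin} Ĉ`;
* integrability of both integrands for `d ≥ 2n+1`, non-negativity, the unit-vector rules
  `srwT_single`/`srwU_single` (`T_{n,l}(e_i) = T_{n,l+1}(0)`, likewise `U`);
* **`srwU_le`**: `U_{n,l}(x) ≤ K_{n,l}(x)/d` (`2n+1 ≤ d`); **`srwT_le_four`**: `T_{n,l}(x) ≤ K_{n,l+1}(x) + (4/d) K_{n,l}(x)`
  (`2n+1 ≤ d`); **`srwT_le_two`**: `T_{n,l}(x) ≤ K_{n,l+1}(x) + (2/d) K_{n+1,l}(x)` (`2(n+1)+1 ≤ d`).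

These are the table entries `T`, `U` of `F3Bounds.Tables` at a node, as functions of the node; the Cauchy–Schwarz
majorant `U ≤ [V_{n,2l} L_n]^{1/2}` ((5.9)) and the `x = 0` identity (5.13) are not reproduced here.
-/

noncomputable section

open MeasureTheory Real Finset
open scoped BigOperators

namespace Literature.Probability.FitznerVanDerHofstad2017

open Literature.Barriers.CriticalPhenomena
open Literature.Barriers.CriticalPhenomena.Slade2006Prop53 (P)

variable {d : ℕ}

/-! ### `D̂^{sin}` and `M̂` -/

/-- `D̂^{sin}(k) = d⁻² Σ_s sin²(k_s)` (`= Σ_s (∂_s D̂(k))²`). [cite: FitznerVanDerHofstad2016NoBLE, §3.3.3 p. 1070] -/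
def Dsin (d : ℕ) (k : Fin d → ℝ) : ℝ :=
  (∑ j, Real.sin (k j) ^ 2) / (d : ℝ) ^ 2

/-- `M̂(k) = D̂(k) − 2 D̂^{sin}(k) Ĉ(k)`, `Ĉ = [1 − D̂]⁻¹`. [cite: FitznerVanDerHofstad2016NoBLE, §3.3.3 p. 1070] -/
def Mhat (d : ℕ) (k : Fin d → ℝ) : ℝ :=
  Dhat d k - 2 * Dsin d k * Chat d 1 k

/-- `D̂^{sin} ≥ 0`. [folklore] -/
theorem Dsin_nonneg (k : Fin d → ℝ) : 0 ≤ Dsin d k :=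
  div_nonneg (Finset.sum_nonneg fun _ _ => sq_nonneg _) (sq_nonneg _)

/-- `D̂^{sin}(k) ≤ 1/d` (each `sin² ≤ 1`). [cite: FitznerVanDerHofstad2016NoBLE, §5.2 p. 1092 ("|D̂^{sin}(k)| ≤ 1/d")] -/
theorem Dsin_le_inv (hd : 1 ≤ d) (k : Fin d → ℝ) : Dsin d k ≤ 1 / d := by
  have hd0 : (0 : ℝ) < d := by exact_mod_cast hd
  have hs : ∑ j, Real.sin (k j) ^ 2 ≤ d := by
    calc ∑ j, Real.sin (k j) ^ 2 ≤ ∑ _j : Fin d, (1 : ℝ) :=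
          Finset.sum_le_sum fun j _ => Real.sin_sq_le_one (k j)
      _ = d := by simp
  rw [Dsin, div_le_div_iff₀ (by positivity) hd0]
  nlinarith

/-- `D̂^{sin}(k) ≤ (2/d)(1 − D̂(k))` (`sin² = (1 − cos)(1 + cos) ≤ 2(1 − cos)` and `1 − D̂ = d⁻¹ Σ (1 − cos k_s)`).
[cite: FitznerVanDerHofstad2016NoBLE, §3.3.3 p. 1070 ((1 − cos²) form of D̂^{sin})] -/
theorem Dsin_le (hd : 1 ≤ d) (k : Fin d → ℝ) : Dsin d k ≤ 2 / d * (1 - Dhat d k) := by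
  haveI : NeZero d := ⟨by omega⟩
  have hd0 : (0 : ℝ) < d := by exact_mod_cast hd
  have hs : ∑ j, Real.sin (k j) ^ 2 ≤ 2 * ∑ j, (1 - Real.cos (k j)) := by
    rw [Finset.mul_sum]
    refine Finset.sum_le_sum fun j _ => ?_
    nlinarith [Real.sin_sq_add_cos_sq (k j), Real.cos_le_one (k j), Real.neg_one_le_cos (k j)]
  rw [one_sub_Dhat, Dsin, div_mul_div_comm, div_le_div_iff₀ (by positivity) (by positivity)]
  nlinarith

/-- `2 D̂^{sin}(k) Ĉ(k) ≤ (2/d) Ĉ(k)`. [cite: FitznerVanDerHofstad2016NoBLE, §5.2 (5.10) p. 1092] -/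
theorem two_mul_Dsin_mul_Chat_le_div (hd : 1 ≤ d) (k : Fin d → ℝ) :
    2 * Dsin d k * Chat d 1 k ≤ 2 / d * Chat d 1 k := by
  have := Dsin_le_inv hd k
  have hC := Chat_one_nonneg k
  calc 2 * Dsin d k * Chat d 1 k ≤ 2 * (1 / d) * Chat d 1 k := by gcongr
    _ = 2 / d * Chat d 1 k := by ring

/-- `2 D̂^{sin}(k) Ĉ(k) ≤ 4/d`. [cite: FitznerVanDerHofstad2016NoBLE, §5.2 (5.10) p. 1092] -/
theorem two_mul_Dsin_mul_Chat_le (hd : 1 ≤ d) (k : Fin d → ℝ) :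
    2 * Dsin d k * Chat d 1 k ≤ 4 / d := by
  have hd0 : (0 : ℝ) < d := by exact_mod_cast hd
  by_cases h : 1 - Dhat d k = 0
  · have : Chat d 1 k = 0 := by rw [Chat, one_mul, h, div_zero]
    rw [this, mul_zero]; positivity
  · have hpos : 0 < 1 - Dhat d k := lt_of_le_of_ne (one_sub_Dhat_nonneg k) (Ne.symm h)
    have hC : Chat d 1 k = 1 / (1 - Dhat d k) := by rw [Chat, one_mul]
    rw [hC]
    have := Dsin_le hd k
    calc 2 * Dsin d k * (1 / (1 - Dhat d k)) ≤ 2 * (2 / d * (1 - Dhat d k)) * (1 / (1 - Dhat d k)) := by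
          gcongr
      _ = 4 / d := by field_simp; ring

/-- `|M̂(k)| ≤ |D̂(k)| + 2 D̂^{sin}(k) Ĉ(k)`. [cite: FitznerVanDerHofstad2016NoBLE, §5.2 (5.10) p. 1092] -/
theorem abs_Mhat_le (k : Fin d → ℝ) : |Mhat d k| ≤ |Dhat d k| + 2 * Dsin d k * Chat d 1 k := by
  have h2 : 0 ≤ 2 * Dsin d k * Chat d 1 k :=
    mul_nonneg (mul_nonneg zero_le_two (Dsin_nonneg k)) (Chat_one_nonneg k)
  rw [Mhat]
  calc |Dhat d k - 2 * Dsin d k * Chat d 1 k| ≤ |Dhat d k| + |2 * Dsin d k * Chat d 1 k| := abs_sub _ _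
    _ = |Dhat d k| + 2 * Dsin d k * Chat d 1 k := by rw [abs_of_nonneg h2]

/-- `D̂^{sin}` is continuous. [folklore] -/
theorem continuous_Dsin (d : ℕ) : Continuous (Dsin d) := by
  unfold Dsin
  exact (continuous_finsetSum _ fun j _ => ((Real.continuous_sin.comp (continuous_apply j)).pow 2)).div_const _

/-- `Ĉ = Chat d 1` is measurable. [folklore] -/
theorem measurable_Chat_one (d : ℕ) : Measurable (Chat d 1) := by
  have : Chat d 1 = fun k => 1 / (1 - 1 * Dhat d k) := rfl
  rw [this]
  exact measurable_const.div (measurable_const.sub (measurable_const.mul (continuous_Dhat d).measurable))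

/-- `M̂` is measurable. [folklore] -/
theorem measurable_Mhat (d : ℕ) : Measurable (Mhat d) :=
  (continuous_Dhat d).measurable.sub
    ((measurable_const.mul (continuous_Dsin d).measurable).mul (measurable_Chat_one d))

/-! ### The integrals `T_{n,l}(x)`, `U_{n,l}(x)` ((3.37), (3.38)), normalised by `(2π)^d` -/

/-- `T_{n,l}(x) = ∫_{[-π,π]^d} |D̂(k)|^l Ĉ(k)ⁿ |D̂^{(x)}(k)| |M̂(k)| dk/(2π)^d`.
[cite: FitznerVanDerHofstad2016NoBLE, (3.37) p. 1071] -/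
def srwT (d n l : ℕ) (x : Fin d → ℤ) : ℝ :=
  (∫ k, (|Dhat d k| ^ l * |DhatSym d x k| * |Mhat d k|) * Chat d 1 k ^ n ∂P d) / (2 * π) ^ d

/-- `U_{n,l}(x) = ∫_{[-π,π]^d} |D̂(k)|^l Ĉ(k)ⁿ |D̂^{(x)}(k)| |D̂^{sin}(k)| dk/(2π)^d` (`D̂^{sin} ≥ 0`).
[cite: FitznerVanDerHofstad2016NoBLE, (3.38) p. 1071] -/
def srwU (d n l : ℕ) (x : Fin d → ℤ) : ℝ :=
  (∫ k, (|Dhat d k| ^ l * |DhatSym d x k| * Dsin d k) * Chat d 1 k ^ n ∂P d) / (2 * π) ^ d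

/-- The `U`-integrand is integrable for `d ≥ 2n + 1`. [folklore] -/
theorem integrable_srwU_integrand {n : ℕ} (hd : 2 * n + 1 ≤ d) (l : ℕ) (x : Fin d → ℤ) :
    Integrable (fun k => (|Dhat d k| ^ l * |DhatSym d x k| * Dsin d k) * Chat d 1 k ^ n) (P d) := by
  have hd1 : 1 ≤ d := by omega
  have hd0 : (1 : ℝ) ≤ d := by exact_mod_cast hd1
  refine integrable_weight_mul_Chat_pow hd
    ((((continuous_Dhat d).measurable.abs.pow_const l).mul (measurable_DhatSym d x).abs).mul
      (continuous_Dsin d).measurable) fun k => ?_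
  rw [abs_mul, abs_mul, abs_abs, abs_of_nonneg (pow_nonneg (abs_nonneg _) l), abs_of_nonneg (Dsin_nonneg k)]
  have h1 : |Dhat d k| ^ l * |DhatSym d x k| ≤ 1 :=
    mul_le_one₀ (abs_Dhat_pow_le_one l k) (abs_nonneg _) (abs_DhatSym_le_one x k)
  have h2 : Dsin d k ≤ 1 := (Dsin_le_inv hd1 k).trans (by rw [div_le_one (by linarith)]; exact hd0)
  exact mul_le_one₀ h1 (Dsin_nonneg k) h2

/-- Pointwise: the `T`-integrand is at most the `K_{n,l+1}`-integrand plus `4/d` times the `K_{n,l}`-integrand.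
[cite: FitznerVanDerHofstad2016NoBLE, §5.2 (5.10)–(5.11) p. 1092] -/
theorem srwT_integrand_le_four (hd : 1 ≤ d) (n l : ℕ) (x : Fin d → ℤ) (k : Fin d → ℝ) :
    (|Dhat d k| ^ l * |DhatSym d x k| * |Mhat d k|) * Chat d 1 k ^ n ≤
      (|Dhat d k| ^ (l + 1) * |DhatSym d x k|) * Chat d 1 k ^ n
        + 4 / d * ((|Dhat d k| ^ l * |DhatSym d x k|) * Chat d 1 k ^ n) := by
  have hA : 0 ≤ |Dhat d k| ^ l * |DhatSym d x k| := mul_nonneg (pow_nonneg (abs_nonneg _) l) (abs_nonneg _)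
  have hC : 0 ≤ Chat d 1 k ^ n := pow_nonneg (Chat_one_nonneg k) n
  have hM : |Mhat d k| ≤ |Dhat d k| + 4 / d := (abs_Mhat_le k).trans (by linarith [two_mul_Dsin_mul_Chat_le hd k])
  calc (|Dhat d k| ^ l * |DhatSym d x k| * |Mhat d k|) * Chat d 1 k ^ n
      ≤ (|Dhat d k| ^ l * |DhatSym d x k| * (|Dhat d k| + 4 / d)) * Chat d 1 k ^ n := by gcongr
    _ = _ := by ring

/-- Pointwise: the `T`-integrand is at most the `K_{n,l+1}`-integrand plus `2/d` times the `K_{n+1,l}`-integrand.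
[cite: FitznerVanDerHofstad2016NoBLE, §5.2 (5.10)–(5.11) p. 1092] -/
theorem srwT_integrand_le_two (hd : 1 ≤ d) (n l : ℕ) (x : Fin d → ℤ) (k : Fin d → ℝ) :
    (|Dhat d k| ^ l * |DhatSym d x k| * |Mhat d k|) * Chat d 1 k ^ n ≤
      (|Dhat d k| ^ (l + 1) * |DhatSym d x k|) * Chat d 1 k ^ n
        + 2 / d * ((|Dhat d k| ^ l * |DhatSym d x k|) * Chat d 1 k ^ (n + 1)) := by
  have hA : 0 ≤ |Dhat d k| ^ l * |DhatSym d x k| := mul_nonneg (pow_nonneg (abs_nonneg _) l) (abs_nonneg _)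
  have hC : 0 ≤ Chat d 1 k ^ n := pow_nonneg (Chat_one_nonneg k) n
  have hM : |Mhat d k| ≤ |Dhat d k| + 2 / d * Chat d 1 k :=
    (abs_Mhat_le k).trans (by linarith [two_mul_Dsin_mul_Chat_le_div hd k])
  calc (|Dhat d k| ^ l * |DhatSym d x k| * |Mhat d k|) * Chat d 1 k ^ n
      ≤ (|Dhat d k| ^ l * |DhatSym d x k| * (|Dhat d k| + 2 / d * Chat d 1 k)) * Chat d 1 k ^ n := by gcongr
    _ = _ := by ring

/-- The `T`-integrand is integrable for `d ≥ 2n + 1`. [folklore] -/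
theorem integrable_srwT_integrand {n : ℕ} (hd : 2 * n + 1 ≤ d) (l : ℕ) (x : Fin d → ℤ) :
    Integrable (fun k => (|Dhat d k| ^ l * |DhatSym d x k| * |Mhat d k|) * Chat d 1 k ^ n) (P d) := by
  have hd1 : 1 ≤ d := by omega
  refine Integrable.mono' ((integrable_srwK_integrand hd (l + 1) x).add
      ((integrable_srwK_integrand hd l x).const_mul (4 / d)))
    (((((continuous_Dhat d).measurable.abs.pow_const l).mul (measurable_DhatSym d x).abs).mul
      (measurable_Mhat d).abs).mul ((measurable_Chat_one d).pow_const n)).aestronglyMeasurable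
    (ae_of_all _ fun k => ?_)
  have h0 : 0 ≤ (|Dhat d k| ^ l * |DhatSym d x k| * |Mhat d k|) * Chat d 1 k ^ n :=
    mul_nonneg (mul_nonneg (mul_nonneg (pow_nonneg (abs_nonneg _) l) (abs_nonneg _)) (abs_nonneg _))
      (pow_nonneg (Chat_one_nonneg k) n)
  rw [Real.norm_eq_abs, abs_of_nonneg h0]
  exact srwT_integrand_le_four hd1 n l x k

/-- `T_{n,l}(x) ≥ 0`. [folklore] -/
theorem srwT_nonneg (n l : ℕ) (x : Fin d → ℤ) : 0 ≤ srwT d n l x :=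
  div_nonneg (integral_nonneg fun k => mul_nonneg
    (mul_nonneg (mul_nonneg (pow_nonneg (abs_nonneg _) l) (abs_nonneg _)) (abs_nonneg _))
    (pow_nonneg (Chat_one_nonneg k) n)) (two_pi_pow_pos d).le

/-- `U_{n,l}(x) ≥ 0`. [folklore] -/
theorem srwU_nonneg (n l : ℕ) (x : Fin d → ℤ) : 0 ≤ srwU d n l x :=
  div_nonneg (integral_nonneg fun k => mul_nonneg
    (mul_nonneg (mul_nonneg (pow_nonneg (abs_nonneg _) l) (abs_nonneg _)) (Dsin_nonneg k))
    (pow_nonneg (Chat_one_nonneg k) n)) (two_pi_pow_pos d).le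

/-- **`U_{n,l}(x) ≤ K_{n,l}(x)/d`** (`d ≥ 2n+1`). [cite: FitznerVanDerHofstad2016NoBLE, §5.2 (5.12) p. 1092] -/
theorem srwU_le {n : ℕ} (hd : 2 * n + 1 ≤ d) (l : ℕ) (x : Fin d → ℤ) :
    srwU d n l x ≤ srwK d n l x / d := by
  have hd1 : 1 ≤ d := by omega
  have hd0 : (0 : ℝ) < d := by exact_mod_cast hd1
  unfold srwU srwK
  rw [div_div, mul_comm ((2 * π) ^ d) (d : ℝ), ← div_div]
  refine div_le_div_of_nonneg_right ?_ (two_pi_pow_pos d).le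
  rw [le_div_iff₀ hd0, ← integral_mul_const]
  refine integral_mono_of_nonneg (ae_of_all _ fun k => ?_)
    (integrable_srwK_integrand hd l x) (ae_of_all _ fun k => ?_)
  · exact mul_nonneg (mul_nonneg (mul_nonneg (mul_nonneg (pow_nonneg (abs_nonneg _) l) (abs_nonneg _))
      (Dsin_nonneg k)) (pow_nonneg (Chat_one_nonneg k) n)) hd0.le
  · have hA : 0 ≤ |Dhat d k| ^ l * |DhatSym d x k| := mul_nonneg (pow_nonneg (abs_nonneg _) l) (abs_nonneg _)
    have hC : 0 ≤ Chat d 1 k ^ n := pow_nonneg (Chat_one_nonneg k) n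
    have hD : Dsin d k * d ≤ 1 := by
      have := Dsin_le_inv hd1 k
      rwa [le_div_iff₀ hd0] at this
    calc (|Dhat d k| ^ l * |DhatSym d x k| * Dsin d k) * Chat d 1 k ^ n * d
        = (|Dhat d k| ^ l * |DhatSym d x k|) * Chat d 1 k ^ n * (Dsin d k * d) := by ring
      _ ≤ (|Dhat d k| ^ l * |DhatSym d x k|) * Chat d 1 k ^ n * 1 := by gcongr
      _ = (|Dhat d k| ^ l * |DhatSym d x k|) * Chat d 1 k ^ n := mul_one _

/-- **`T_{n,l}(x) ≤ K_{n,l+1}(x) + (4/d) K_{n,l}(x)`** (`d ≥ 2n+1`). [cite: FitznerVanDerHofstad2016NoBLE, §5.2 (5.11) p. 1092] -/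
theorem srwT_le_four {n : ℕ} (hd : 2 * n + 1 ≤ d) (l : ℕ) (x : Fin d → ℤ) :
    srwT d n l x ≤ srwK d n (l + 1) x + 4 / d * srwK d n l x := by
  have hd1 : 1 ≤ d := by omega
  unfold srwT srwK
  rw [mul_div_assoc', ← add_div]
  refine div_le_div_of_nonneg_right ?_ (two_pi_pow_pos d).le
  rw [← integral_const_mul, ← integral_add (integrable_srwK_integrand hd (l + 1) x)
    ((integrable_srwK_integrand hd l x).const_mul _)]
  refine integral_mono_of_nonneg (ae_of_all _ fun k => ?_)
    ((integrable_srwK_integrand hd (l + 1) x).add ((integrable_srwK_integrand hd l x).const_mul _))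
    (ae_of_all _ fun k => srwT_integrand_le_four hd1 n l x k)
  exact mul_nonneg (mul_nonneg (mul_nonneg (pow_nonneg (abs_nonneg _) l) (abs_nonneg _)) (abs_nonneg _))
    (pow_nonneg (Chat_one_nonneg k) n)

/-- **`T_{n,l}(x) ≤ K_{n,l+1}(x) + (2/d) K_{n+1,l}(x)`** (`d ≥ 2(n+1)+1`). [cite: FitznerVanDerHofstad2016NoBLE, §5.2 (5.11) p. 1092] -/
theorem srwT_le_two {n : ℕ} (hd : 2 * (n + 1) + 1 ≤ d) (l : ℕ) (x : Fin d → ℤ) :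
    srwT d n l x ≤ srwK d n (l + 1) x + 2 / d * srwK d (n + 1) l x := by
  have hd1 : 1 ≤ d := by omega
  have hd' : 2 * n + 1 ≤ d := by omega
  unfold srwT srwK
  rw [mul_div_assoc', ← add_div]
  refine div_le_div_of_nonneg_right ?_ (two_pi_pow_pos d).le
  rw [← integral_const_mul, ← integral_add (integrable_srwK_integrand hd' (l + 1) x)
    ((integrable_srwK_integrand hd l x).const_mul _)]
  refine integral_mono_of_nonneg (ae_of_all _ fun k => ?_)
    ((integrable_srwK_integrand hd' (l + 1) x).add ((integrable_srwK_integrand hd l x).const_mul _))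
    (ae_of_all _ fun k => srwT_integrand_le_two hd1 n l x k)
  exact mul_nonneg (mul_nonneg (mul_nonneg (pow_nonneg (abs_nonneg _) l) (abs_nonneg _)) (abs_nonneg _))
    (pow_nonneg (Chat_one_nonneg k) n)

/-- `T_{n,l}(e_i) = T_{n,l+1}(0)` (an identity of integrands). [cite: FitznerVanDerHofstad2016NoBLE, (3.34), (3.37) p. 1071] -/
theorem srwT_single (n l : ℕ) (i : Fin d) :
    srwT d n l (Pi.single i 1) = srwT d n (l + 1) 0 := by
  unfold srwT
  congr 1
  refine integral_congr_ae (ae_of_all _ fun k => ?_)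
  simp only [DhatSym_single, DhatSym_zero, abs_one, mul_one, pow_succ]

/-- `U_{n,l}(e_i) = U_{n,l+1}(0)`. [cite: FitznerVanDerHofstad2016NoBLE, (3.34), (3.38) p. 1071] -/
theorem srwU_single (n l : ℕ) (i : Fin d) :
    srwU d n l (Pi.single i 1) = srwU d n (l + 1) 0 := by
  unfold srwU
  congr 1
  refine integral_congr_ae (ae_of_all _ fun k => ?_)
  simp only [DhatSym_single, DhatSym_zero, abs_one, mul_one, pow_succ]

end Literature.Probability.FitznerVanDerHofstad2017
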